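import Summits.QuantumFields.BalabanUV.Beta.EriceFlowEnclosureB12AsPrintedPointwiseFadingOrderSharpFold

/-!
# Beta / EriceFlowEnclosureB12AsPrintedPointwiseFadingOrderSharpFoldMarkov — WHAT (0.31) FORCES POINTWISE, part 7♯, THE MARKOV FOLD AT THE EDGE.  At θ = 0 (last-only moduli,
# `FadingMemory C 0 Λ`) node U2's `T4TwoRunUniqueness.eq_of_pin_lastOnly` (Lγ³ < 2) and `…Sharp.order_preserved_markov` (Cγ³ < 2) give uniqueness ∕ order of same-length runs below
# **Cγ³ = 2** — row U's linearised injectivity threshold of the one-step chart map x ↦ x − β(x^{−1∕2}) (slope ≥ 1 − Cγ³∕2).  Prover 1's Markov folds sit at Cγ³ = 6 (#63d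
# `no_threshold_without_reference`); `…SharpThreshold.order_reversal_markov_edge` reverses the ORDER in one step for every c > 2.  HERE the fold itself, for EVERY c > 2
# (**`nonunique_markov_edge`**): C ≥ 0, γ > 0 with Cγ³ ≤ c, last-only Λ, the Markov clamp family β_{k+1}(g_{≤k}) = C·φ_τ(1 − g_k) with `HistLipschitz Λ γ β`, and two runs of (0.20) of
# length ONE inside ]0, γ] — g′ ≡ 1 and g started at some s* < 1 — with g_1 = g′_1 = 1: the one-step map FOLDS.  (The band start s₀ jumps above 1 in one step, the far start ½ stays
# below, the one-step map is continuous in the start (`…SharpFold.tbl_continuousOn` at θ = 0), intermediate value; clamp width τ = min(τ₁, τ₁∕C) against the box margin τ₁ of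
# `constants_exist`.)  So at θ = 0 too the threshold is attained from both sides, the single value c = 2 excepted
# (β-flow team, prover 2 = lower ∕ positivity side, unit `b2b-balaban-beta-bflow-p2`, gen 45; ROW AP-I × node U2's letters and `T4TwoRunUniqueness` §3 (ii); a TOY FAMILY of ours)

HONEST FRAMING (page 1 of everything the β sub-cell writes): discharging `BetaPertH` makes Bałaban's UV stability UNCONDITIONAL — a
real constructive-QFT result; it is NOT the continuum limit and NOT the Clay problem.  HONEST DEPENDENCY (cell reorg 2026-08-19,
verbatim): «continuum YM on T⁴ ⇐ BetaPertH ∧ nine spine estimates (0/9 proved); BetaPertH ⇐ (D1) ∧ (D4) ∧ CAP+tail; G-an2-4 gates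
asym, D1 and NE2/3/4.»  THIS MODULE DISCHARGES NOTHING: it is elementary real analysis about an EXPLICIT TOY family (ours — NOT Bałaban's β of
[I] = T. Bałaban, Commun. Math. Phys. **109** (1987) [Balaban1987RG1] (1.22) p. 264; (0.20) p. 256 is Markov in print, the uniform Lipschitz constant is NOT printed — p. 264's
derivative clause is qualitative, GAPS G-adv2-3).  Uniqueness of g₀ is NOT printed (Theorem 2 p. 259 is an existence statement, STATED WITHOUT PROOF — DELTA-I D-21).

WHAT THIS FILE PROVES (0 sorry, 0 def): **`nonunique_markov_edge`**.
NOT CLAIMED: the boundary value c = 2; anything about Bałaban's β; Theorem 2; `BetaPertH`; continuum; Clay.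
-/

namespace Summit.QuantumFields.BalabanUV.Beta.EriceFlowEnclosureB12AsPrintedPointwiseFadingOrderSharpFoldMarkov

open Finset Set
open Literature.MathematicalPhysics.QuantumFieldTheory.Balaban1983to89
open Literature.MathematicalPhysics.QuantumFieldTheory.Balaban1983to89.FlowStep (HBeta prefixOf Box mem_box RGEqH)
open Literature.MathematicalPhysics.QuantumFieldTheory.Balaban1983to89.T4CouplingMatching (HistLipschitz FadingMemory)
open Summit.QuantumFields.BalabanUV.Beta.EriceFlowEnclosureB12AsPrintedPointwiseFadingOrderSharpWitness
open Summit.QuantumFields.BalabanUV.Beta.EriceFlowEnclosureB12AsPrintedPointwiseFadingOrderSharpWitnessEnd (constants_exist clampRun)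
open Summit.QuantumFields.BalabanUV.Beta.EriceFlowEnclosureB12AsPrintedPointwiseFadingOrderSharpFold

noncomputable section

/-- **THE MARKOV CLAMP FAMILY FOLDS FOR EVERY c > 2.**  For every c > 2 there are C ≥ 0, γ > 0 with Cγ³ ≤ c, LAST-ONLY moduli Λ k i = C·0^{k−i} (`FadingMemory C 0 Λ`), a β with
`HistLipschitz Λ γ β` (β_{k+1}(g_{≤k}) = C·φ_τ(1 − g_k)), and two runs g, g′ of (0.20) of length 1 inside ]0, γ] with g_0 < g′_0 and g_1 = g′_1: two bare couplings, one renormalized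
coupling, one step.  Node U2's `eq_of_pin_lastOnly` (Lγ³ < 2) is sharp up to the boundary value. [cite: Balaban1987RG1, (0.20) p.256 with §1 p.264 and Thm 2 p.259 («g₀ = g₀(ε, g)»)] -/
theorem nonunique_markov_edge {c : ℝ} (hc : 2 < c) :
    ∃ (C γ : ℝ) (Λ : ℕ → ℕ → ℝ) (β : HBeta) (g g' : ℕ → ℝ),
      0 ≤ C ∧ 0 < γ ∧ C * γ ^ 3 ≤ c ∧ FadingMemory C 0 Λ ∧ HistLipschitz Λ γ β ∧
      RGEqH 1 β g ∧ RGEqH 1 β g' ∧ (∀ i, i ≤ 1 → 0 < g i ∧ g i ≤ γ) ∧ (∀ i, i ≤ 1 → 0 < g' i ∧ g' i ≤ γ) ∧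
      g 0 < g' 0 ∧ g 1 = g' 1 := by
  have hc' : 2 * (1 - Real.sqrt 0) ^ 2 < c := by rw [Real.sqrt_zero]; linarith
  obtain ⟨C, τ₁, hC0, hτ₁0, hτ₁4, hCγ, hcm⟩ := constants_exist hc'
  rw [Real.sqrt_zero, sub_zero, one_pow] at hcm
  -- the clamp width: one-step drift C·τ ≤ τ₁
  set τ : ℝ := min τ₁ (τ₁ / C) with hτ
  have hτ0 : 0 < τ := by rw [hτ]; exact lt_min hτ₁0 (by positivity)
  have hττ₁ : τ ≤ τ₁ := by rw [hτ]; exact min_le_left _ _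
  have hτle : τ ≤ τ₁ / C := by rw [hτ]; exact min_le_right _ _
  clear_value τ
  have hτ1 : τ ≤ 1 := by linarith
  have hB0 : 0 ≤ C * τ / (1 - 0) := by rw [sub_zero, div_one]; positivity
  have hdrift : ((1 : ℕ) : ℝ) * (C * τ / (1 - 0)) ≤ τ₁ := by
    rw [Nat.cast_one, one_mul, sub_zero, div_one]
    calc C * τ ≤ C * (τ₁ / C) := mul_le_mul_of_nonneg_left hτle hC0.le
      _ = τ₁ := by field_simp
  have hdrift34 : ((1 : ℕ) : ℝ) * (C * τ / (1 - 0)) ≤ 3 / 4 := hdrift.trans (by linarith)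
  -- the (Markov) clamp family at θ = 0, width τ
  let βt : HBeta := fun k q => C * ∑ i : Fin (k + 1), (0 : ℝ) ^ (k - (i : ℕ)) * max (-τ) (min τ (1 - q i))
  have hβ : ∀ (k : ℕ) (q : Fin (k + 1) → ℝ),
      βt k q = C * ∑ i : Fin (k + 1), (0 : ℝ) ^ (k - (i : ℕ)) * max (-τ) (min τ (1 - q i)) := fun _ _ => rfl
  -- growth factor and start of the band run
  set M : ℝ := 1 + 2 * C / (1 - 0) with hM
  have hM1 : 1 ≤ M := by
    have : 0 ≤ 2 * C / (1 - 0) := by rw [sub_zero, div_one]; linarith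
    rw [hM]; linarith
  have hMpos : 0 < M := by linarith
  clear_value M
  have hMN : 0 < M ^ 1 := pow_pos hMpos _
  set δ₀ : ℝ := τ / (2 * M ^ 1) with hδ₀
  have hδ : 0 < δ₀ := by rw [hδ₀]; positivity
  have hN : M ^ 1 * δ₀ ≤ τ / 2 := by
    rw [hδ₀, mul_div_assoc', mul_comm (M ^ 1) τ, mul_div_mul_right _ _ hMN.ne']
  clear_value δ₀
  have hδsmall : δ₀ ≤ 3 := by
    have h1 : 1 * δ₀ ≤ M ^ 1 * δ₀ := mul_le_mul_of_nonneg_right (one_le_pow₀ hM1) hδ.le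
    linarith
  -- start-indexed forward tables
  let tbl : ℝ → ℕ → ℕ → ℝ := fun s k => Nat.rec (motive := fun _ => ℕ → ℝ) (fun _ => s)
      (fun k t i => if i ≤ k then t i else 1 / Real.sqrt (1 / (t k) ^ 2 - βt k (fun j : Fin (k + 1) => t j))) k
  have hcs : ∀ (s : ℝ) (k i : ℕ), tbl s (k + 1) i =
      if i ≤ k then tbl s k i else 1 / Real.sqrt (1 / (tbl s k k) ^ 2 - βt k (fun j : Fin (k + 1) => tbl s k j)) :=
    fun _ _ _ => rfl
  have h0 : ∀ (s : ℝ) (i : ℕ), tbl s 0 i = s := fun _ _ => rfl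
  clear_value tbl βt
  -- the band start jumps above 1 in one step
  obtain ⟨hs00, hs01, hs0D⟩ := start_facts hδ
  set s₀ : ℝ := 1 / Real.sqrt (1 + δ₀) with hs₀
  clear_value s₀
  obtain ⟨hin, hrg0⟩ := clampRun hβ hC0.le le_rfl zero_lt_one hτ1 hM hδ hN (hcs s₀) ((h0 s₀ 0).trans hs₀)
  have hpos0 : ∀ i, i ≤ 1 → 0 < tbl s₀ i i := fun i hi => (hin i hi).1
  have hband0 : ∀ i, i ≤ 1 → |1 - tbl s₀ i i| ≤ τ := fun i hi =>
    (abs_one_sub_le_of_inv_sq (hpos0 i hi) (by linarith)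
      (((hin i hi).2.trans (mul_le_mul_of_nonneg_right (pow_le_pow_right₀ hM1 hi) hδ.le)).trans hN)).trans
      (by linarith)
  have hD0 : 0 < 1 / (tbl s₀ 0 0) ^ 2 - 1 := by rw [h0, hs0D]; exact hδ
  have hrec0 := band_recursion hβ hrg0 hpos0 hband0 (k := 0) zero_lt_one
  rw [Finset.sum_range_one, Nat.sub_self, pow_zero, one_mul] at hrec0
  have hcl : C * ((1 - τ₁) ^ 2 / (2 + τ₁)) ≤ C * ((tbl s₀ 0 0) ^ 2 / (1 + tbl s₀ 0 0)) :=
    (coeffLower_antitone (C := C) hC0.le hτ0.le hττ₁ (by linarith)).trans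
      (mul_le_mul_of_nonneg_left (coeff_lower hτ1 (hband0 0 (Nat.zero_le _))) hC0.le)
  have hD1 : 1 / (tbl s₀ (0 + 1) (0 + 1)) ^ 2 - 1 < 0 := by
    rw [hrec0]
    nlinarith [mul_lt_mul_of_pos_right (lt_of_lt_of_le hcm hcl) hD0]
  have hge : 1 ≤ tbl s₀ 1 1 := by
    have h := hD1
    simp only [Nat.zero_add] at h
    exact one_le_of_D_nonpos (hpos0 1 le_rfl) h.le
  -- the far start 1/2 stays below 1
  obtain ⟨hinH, -⟩ := crudeRun hβ hC0.le le_rfl zero_lt_one hτ0.le (s := 1 / 2) (by norm_num) (by norm_num)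
    hdrift34 (hcs (1 / 2)) (h0 (1 / 2) 0)
  have hlt : tbl (1 / 2) 1 1 < 1 := by
    obtain ⟨hpH, hxH⟩ := hinH 1 le_rfl
    have hx1 : 1 < 1 / (tbl (1 / 2) 1 1) ^ 2 := by
      have e : (1 : ℝ) / (1 / 2) ^ 2 = 4 := by norm_num
      rw [e, Nat.cast_one, one_mul] at hxH
      have h1B : C * τ / (1 - 0) ≤ 3 / 4 := by rw [Nat.cast_one, one_mul] at hdrift34; exact hdrift34
      linarith
    by_contra hge'
    have h1 : 1 ≤ tbl (1 / 2) 1 1 := le_of_not_gt hge'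
    have h2 : 1 / (tbl (1 / 2) 1 1) ^ 2 ≤ 1 := by
      rw [div_le_one (by positivity)]; exact one_le_pow₀ h1
    linarith
  -- continuity of the one-step map in the start and the intermediate value
  have hs0le1 : s₀ ≤ 1 := hs01.le
  have hhalf : (1 : ℝ) / 2 ≤ s₀ := by
    have hsq4 : Real.sqrt (1 + δ₀) ≤ 2 := by
      have h := Real.sqrt_le_sqrt (by linarith : 1 + δ₀ ≤ 4)
      rwa [show (4 : ℝ) = 2 ^ 2 by norm_num, Real.sqrt_sq (by norm_num : (0 : ℝ) ≤ 2)] at h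
    rw [hs₀]
    exact one_div_le_one_div_of_le (Real.sqrt_pos.mpr (by linarith)) hsq4
  have hcont : ContinuousOn (fun s => tbl s 1 1) (Icc (1 / 2 : ℝ) s₀) :=
    (tbl_continuousOn hβ hC0.le le_rfl zero_lt_one hτ0.le hdrift34 hcs h0 1 le_rfl 1).mono
      (Icc_subset_Icc_right hs0le1)
  obtain ⟨sStar, hsI, hsEq⟩ := intermediate_value_Icc hhalf hcont ⟨hlt.le, hge⟩
  have hsS0 : 0 < sStar := by linarith [hsI.1]
  have hsS1 : sStar ≤ 1 := hsI.2.trans hs0le1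
  obtain ⟨hinS, hrgS⟩ := crudeRun hβ hC0.le le_rfl zero_lt_one hτ0.le hsS0 hsS1 hdrift34 (hcs sStar) (h0 sStar 0)
  have hboxS : ∀ i, i ≤ 1 → 0 < tbl sStar i i ∧ tbl sStar i i ≤ 1 + τ₁ := by
    intro i hi
    obtain ⟨hpS, hxS⟩ := hinS i hi
    refine ⟨hpS, le_one_add_of_inv_sq hτ₁0.le (by linarith) ?_⟩
    have hiB : (i : ℝ) * (C * τ / (1 - 0)) ≤ τ₁ :=
      (mul_le_mul_of_nonneg_right (by exact_mod_cast hi) hB0).trans hdrift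
    have hs2 : 1 ≤ 1 / sStar ^ 2 := by
      rw [le_div_iff₀ (by positivity), one_mul]; exact pow_le_one₀ hsS0.le hsS1
    linarith
  refine ⟨C, 1 + τ₁, fun k i => C * (0 : ℝ) ^ (k - i), βt, fun k => tbl sStar k k, fun _ => 1, hC0.le, by linarith,
    hCγ, fadingMemory_clamp hC0.le le_rfl, histLipschitz_clamp hβ hC0.le le_rfl _, hrgS, rgEqH_const hβ hτ0.le _,
    hboxS, fun i _ => ⟨one_pos, by linarith⟩, ?_, ?_⟩
  · show tbl sStar 0 0 < 1
    rw [h0]; exact lt_of_le_of_lt hsI.2 hs01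
  · show tbl sStar 1 1 = 1
    exact hsEq

end

end Summit.QuantumFields.BalabanUV.Beta.EriceFlowEnclosureB12AsPrintedPointwiseFadingOrderSharpFoldMarkov
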